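import Summits.QuantumFields.BalabanUV.Beta.FP.TowerQN1Row

/-!
# `BalabanUV.Beta.FP.TowerN1RowsFamily` — road «FP», binder row D1, ROUTE T (β1): **THE END WRAPPER's FIRST-ORDER CONTENT ROWS `hHN₁ ∕ hQN₁` AS FAMILIES IN THE LABEL
# `(μ, y)`, `y ∈ ℤ⁴` ARBITRARY** — with the source type `κ := pbox M × Fin 4` (v4's `κ B`), labels `yN a := a.1`, `μN a := a.2`, and the direction family
# `dv (μ, y) := r • e_(wrapPt M y, μ)` (one top one-shot source per label, SPEC-46 §B′ ∕ R-FP-72), the one-direction theorems `TowerHN1Row.hHN1_of_road_data` ∕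
# `TowerQN1Row.hQN1_of_road_data` give v4's rows `hHN₁ n μ y B` ∕ `hQN₁ n μ y B` for EVERY `y : ℤ⁴`, because the periodised N-vertex is `(Mc B)`-PERIODIC IN ITS SOURCE:
# `perF T (dper T (VN R P (n+1) μ (y + M∘m))) = perF T (dper T (VN R P (n+1) μ y))` (SPEC-53 §C.1; an2 g66 W-2 (3)(ii))

WHY.  v4 (`FP/StepRecursionFeedNestedNamedC`) quantifies `hHN₁ ∕ hQN₁` over `(μ : Fin 4) (y : ℤ⁴)` while the road's one-direction theorems read the label off a source
`a : κ` (`VN … (μN a) (yN a)`, `yN a ∈ pbox (Mc B)`).  The N-vertex `VN R P (n+1) μ y = vertexOfK (AN R (n+1)) L (JNat R P (n+2)).S μ y`, `L = Lc^(n+2)`, is block-covariant in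
its source: `VN … μ (y + t) = shiftK (−L•t) (VN … μ y)` (lit `BalabanStepJetsSucc.vertexOfK_translate_block` with the chart's block invariance `shiftK_compChart` and the sector
covariance an2 PART 11 `JNat_S_St`); for `t = M∘m` the shift `L•t = T∘m` is a period of the finest torus `T = towerTorus Lc (fine Lc M) (n+1)` (`T i = L·M i`), and the diagonal
periodisation `dper T` is blind to a simultaneous `T`-period shift (re-indexing the period sum).  So `y ↦ wrap M y` costs nothing and the families follow.

WHAT ([folklore] bookkeeping BY NAME; no `def`, no `def … : Prop`, nothing cited, 0 sorry): §1 `dper_shiftK_period` (any box, any fibre), `VN_translate_eq_shiftK`,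
**`perF_dper_VN_translate`**, **`perF_dper_VN_wrap`**; §2 **`hHN1_family_of_road_data`**, **`hQN1_family_of_road_data`** — v4's `hHN₁ ∕ hQN₁` right sides VERBATIM for every
`(μ, y)`, from the FAMILY namings `H₁f H′₁f 𝔔₁f 𝔔′₁f Q₁₁f Q₂₁f Xbf : (κ → ℝ) → Matrix …` with their v4 letters `∀ v`, at `dv (μ, y)`, modulo the same instantiation letters and the three
scalar rows `hr ∕ hcΛ ∕ hcVH` as the one-direction theorems (the column letter `hJW` now reads `colN̂_a` at `wrapPt T (L•↑a.1)`).
WHAT THIS IS NOT: not the `∀ n B` packaging (one depth `n`, one box `M := Mc B` — the wrapper's `∀ n B` is `fun n B => …`); not `hJW`'s instantiation (g39 #5 at the pins);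
not second order; nothing of Bałaban's asserted, valued or discharged; 0 estimates; 0∕4 row-D1 binders (hW, hR, D1Tel, D1Rep); ROOT M‴ p325680 ∕ P5c ∕ D6 untouched; NOT (C1),
NOT (L2′), NOT (T-ID), NOT SDF, NOT D1, NEVER «G-an2-4 closed», NOT BetaPertH, NOT continuum, NOT Clay.

HONEST DEPENDENCY (page 1, mandatory): continuum YM on T⁴ ⇐ BetaPertH ∧ nine spine estimates (0/9 proved); BetaPertH ⇐ (D1) ∧ (D4) ∧ CAP+tail;
G-an2-4 gates asym, D1 and NE2/3/4.  HONEST FRAMING (cell contract, verbatim): «discharging `BetaPertH` makes Bałaban's UV stability UNCONDITIONAL —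
a real constructive-QFT result; it is NOT the continuum limit and NOT the Clay problem.»  ABSOLUTE RULE (cell charter, verbatim): «No internally-minted
statement may enter as a cited fact. Every hypothesis is either kernel-proved in this package or a verbatim quotation of a PUBLISHED theorem with page
reference. The manuscript(s) under audit are NOT citable for their own disputed steps — they are the thing under adjudication; programme-internal
(2001/route/tribunal) claims are never citable.»  Road «FP» OWNER, b2b-balaban-beta-d1-p3 gen 42, 2026-08-27.  No existing file touched.
-/

noncomputable section

open scoped BigOperators

namespace Summit.QuantumFields.BalabanUV.Beta.FP.TowerN1RowsFamily

open Finset Matrix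
open Literature.MathematicalPhysics.QuantumFieldTheory
open Literature.MathematicalPhysics.QuantumFieldTheory.Balaban1983to89
open Literature.MathematicalPhysics.QuantumFieldTheory.Balaban1983to89.Beta
open B4TorusKernel.MultiPeriod (translate)
open B4Reflection242 (translate_translate)
open B5Prop11Plancherel (fine)
open B6Lemma24Torus (pbox wrap)
open AffineAveraging (Site box toSite)
open AveragingContoursRooted (ctr ctrOff)
open ExpKernelCalculus (MKer shiftK)
open OneStepResolventKernel (Fib KInv)
open OneStepKernelFamily (vertexOfK)
open InterLevelTransport (SLam)
open BalabanStepJets (lamCoeffOf)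
open StepJetData (wilsonA)
open BalabanStepJetsSucc (vertexOfK_translate_block)
open Summit.QuantumFields.BalabanUV.Beta.AxialDressingRooted (one_le_of_neZero)
open Summit.QuantumFields.BalabanUV.Beta.BorderedHessian (stepScale)
open Summit.QuantumFields.BalabanUV.Beta.SymShiftedSpread (bhKStepSh)
open Summit.QuantumFields.BalabanUV.Beta.DshAn1 (Dsh)
open Summit.QuantumFields.BalabanUV.Beta.SymAveragingHessianCounts (symLinKerAt symHessFFAt symVhSAt)
open Summit.QuantumFields.BalabanUV.Beta.CompositeVertexKernelRec (compLinKer)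
open Summit.QuantumFields.BalabanUV.Beta.CompositeOneShotJets (compH shiftK_compChart)
open Summit.QuantumFields.BalabanUV.Beta.CompositeOneShotJetData (Roots Pins AN VN JNat AN_eq VN_eq)
open Summit.QuantumFields.BalabanUV.Beta.NVertexSectorsPeriodised (JNat_S_St)
open Summit.QuantumFields.BalabanUV.Beta.FP.KernelPeriodisationFib (Idx perF)
open Summit.QuantumFields.BalabanUV.Beta.FP.KernelPeriodisationFibLoc (dper dper_apply shiftK_eq_translate)
open Summit.QuantumFields.BalabanUV.Beta.GAN24.KernelPeriodisation (quo translate_wrap_quo)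
open Summit.QuantumFields.BalabanUV.Beta.FP.TorusGaugeCovariance (tgrad)
open Summit.QuantumFields.BalabanUV.Beta.FP.TorusGaugeCovariancePairing (wrapPt wrapPt_coe)
open Summit.QuantumFields.BalabanUV.Beta.FP.TorusGaugeCovarianceCoarse (coarsePt)
open Summit.QuantumFields.BalabanUV.Beta.FP.TorusCompositeObjects (towerTorus towerTorus_apply)
open Summit.QuantumFields.BalabanUV.Beta.FP.TorusCompositeObjectsG (compRowsSym)
open Summit.QuantumFields.BalabanUV.Beta.FP.TorusCompositeCompanionSumG (compSumSym)
open Summit.QuantumFields.BalabanUV.Beta.FP.TorusCompositeCompanionFamilyG (onTowerFamily)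
open Summit.QuantumFields.BalabanUV.Beta.FP.TorusCompositeCovariance (itRoot)
open Summit.QuantumFields.BalabanUV.Beta.FP.TorusCompositeCovarianceOneSym (compIns₁Sym)
open Summit.QuantumFields.BalabanUV.Beta.FP.TowerHN1Row (hHN1_of_road_data)
open Summit.QuantumFields.BalabanUV.Beta.FP.TowerQN1Row (hQN1_of_road_data)

variable {Lc : ℕ} [NeZero Lc] (R : Roots Lc) (P : Pins) (n : ℕ) (M : Fin (3 + 1) → ℕ) [∀ i, NeZero (M i)]

/-! ## §1 The periodised N-vertex is `(Mc B)`-periodic in its source -/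

section Periodicity

omit [NeZero Lc] in
/-- [folklore] **`dper_shiftK_period` — THE DIAGONAL PERIODISATION IS BLIND TO A SIMULTANEOUS PERIOD SHIFT**: `dper T (shiftK (T∘m) V) = dper T V` (re-index the period sum;
no convergence needed). -/
theorem dper_shiftK_period {F : Type*} (T : Fin (3 + 1) → ℕ) (V : MKer (3 + 1) F) (m : Site (3 + 1)) :
    dper T (shiftK (fun i => (T i : ℤ) * m i) V) = dper T V := by
  funext x z a b
  simp only [dper_apply, shiftK_eq_translate, translate_translate]
  exact (Equiv.addRight m).tsum_eq (fun m' => V (translate T x m') (translate T z m') a b)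

omit [∀ i, NeZero (M i)] in
/-- [folklore] **`VN_translate_eq_shiftK` — THE N-VERTEX IS BLOCK-COVARIANT IN ITS SOURCE**: a source shift by a period `M∘m` of the coarse box is a simultaneous shift of
both lattice arguments by the period `T∘m` of the finest torus `T = towerTorus Lc (fine Lc M) (n+1)` (lit `vertexOfK_translate_block` with `shiftK_compChart` and an2 PART 11
`JNat_S_St`; `Lc^(n+2)·M i = T i`). -/
theorem VN_translate_eq_shiftK (μ : Fin (3 + 1)) (y m : Site (3 + 1)) :
    VN R P (n + 1) μ (translate M y m)
      = shiftK (fun i => (towerTorus Lc (fine Lc M) (n + 1) i : ℤ) * (-m) i) (VN R P (n + 1) μ y) := by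
  have hKs : ∀ t : Site (3 + 1), shiftK (-(((Lc ^ (n + 1 + 1) : ℕ) : ℤ) • t)) (AN R (n + 1)) = AN R (n + 1) := fun t => by
    rw [AN_eq]; exact shiftK_compChart (rc := R.rc) (s := R.s (n + 1 + 1)) (one_le_of_neZero Lc) (n + 1 + 1) t
  have ht : translate M y m = y + (fun i => (M i : ℤ) * m i) := by
    funext i; simp only [B4TorusKernel.MultiPeriod.translate_apply, Pi.add_apply]
  have hvec : -(((Lc ^ (n + 1 + 1) : ℕ) : ℤ) • (fun i => (M i : ℤ) * m i)) = fun i => (towerTorus Lc (fine Lc M) (n + 1) i : ℤ) * (-m) i := by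
    funext i
    simp only [Pi.neg_apply, Pi.smul_apply, smul_eq_mul, towerTorus_apply]
    push_cast
    ring
  rw [VN_eq, ht, vertexOfK_translate_block (hKs) (fun κ' u t => JNat_S_St R P (n + 1) κ' u t) μ y, hvec]

omit [∀ i, NeZero (M i)] in
/-- [folklore] **`perF_dper_VN_translate` — THE PERIODISED N-VERTEX IS `M`-PERIODIC IN ITS SOURCE** on `T = towerTorus Lc (fine Lc M) (n+1)`. -/
theorem perF_dper_VN_translate (μ : Fin (3 + 1)) (y m : Site (3 + 1)) :
    perF (towerTorus Lc (fine Lc M) (n + 1)) (dper (towerTorus Lc (fine Lc M) (n + 1)) (VN R P (n + 1) μ (translate M y m)))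
      = perF (towerTorus Lc (fine Lc M) (n + 1)) (dper (towerTorus Lc (fine Lc M) (n + 1)) (VN R P (n + 1) μ y)) := by
  rw [VN_translate_eq_shiftK R P n M μ y m, dper_shiftK_period]

omit [∀ i, NeZero (M i)] in
/-- [folklore] **`perF_dper_VN_wrap`** — hence the source may be read at its box representative: `… (VN R P (n+1) μ (wrap M y)) = … (VN R P (n+1) μ y)` (`translate_wrap_quo`). -/
theorem perF_dper_VN_wrap (μ : Fin (3 + 1)) (y : Site (3 + 1)) :
    perF (towerTorus Lc (fine Lc M) (n + 1)) (dper (towerTorus Lc (fine Lc M) (n + 1)) (VN R P (n + 1) μ (wrap M y)))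
      = perF (towerTorus Lc (fine Lc M) (n + 1)) (dper (towerTorus Lc (fine Lc M) (n + 1)) (VN R P (n + 1) μ y)) := by
  conv_rhs => rw [← translate_wrap_quo M y]
  exact (perF_dper_VN_translate R P n M μ (wrap M y) (quo M y)).symm

end Periodicity

/-! ## §2 The families `hHN₁ ∕ hQN₁` in the label `(μ, y)` -/

section Families

variable (N₁ : ℕ) [NeZero N₁] (lev : ℕ → ℕ) (hlev : ∀ i ≤ n + 1, lev i = n + 1 - i) (rs : ℕ → (Fin (3 + 1) → ℕ)) (c : ℝ) (hc : ctrOff (3 + 1) Lc ∈ box (3 + 1) Lc)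
  -- the nested column on the sources `κ := pbox M × Fin 4`, its read-out, the (J-W″) letter at `r := 1` read at the source slot `(wrapPt T (L•↑a.1), inr a.2)`
  (hv : ((↥(pbox M) × Fin (3 + 1)) → ℝ) → (↥(pbox (towerTorus Lc (fine Lc M) (n + 1))) × Fin (3 + 1) → ℝ))
  (hhvl : ∀ (r : ℝ) (x y : (↥(pbox M) × Fin (3 + 1)) → ℝ), hv (r • x + y) = r • hv x + hv y)
  (lv : ((↥(pbox M) × Fin (3 + 1)) → ℝ) → ↥(pbox (towerTorus Lc (fine Lc M) (n + 1))) → ℝ)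
  (hlv : ∀ (r : ℝ) (x y : (↥(pbox M) × Fin (3 + 1)) → ℝ), lv (r • x + y) = r • lv x + lv y)
  (hJW : ∀ (a : ↥(pbox M) × Fin (3 + 1)) (b : ↥(pbox (towerTorus Lc (fine Lc M) (n + 1))) × Fin (3 + 1)), hv (Pi.single a 1) b
      = perF (towerTorus Lc (fine Lc M) (n + 1)) (AN (Roots.ctr Lc) (n + 1)) (b.1, Sum.inl b.2)
          (wrapPt (towerTorus Lc (fine Lc M) (n + 1)) (((Lc ^ (n + 1 + 1) : ℕ) : ℤ) • (a.1 : Site (3 + 1))), Sum.inr a.2)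
        - ∑ s : ↥(pbox (towerTorus Lc (fine Lc M) (n + 1))), tgrad (towerTorus Lc (fine Lc M) (n + 1)) (b.1, Sum.inl b.2) s * lv (Pi.single a 1) s)
  -- the direction FAMILY: one top one-shot source per label, scaled by the pin's `r`
  (r : ℝ) (hr : (-2 * c) * r = P.cE (n + 1 + 1))
  (dv : Fin (3 + 1) × Site (3 + 1) → ((↥(pbox M) × Fin (3 + 1)) → ℝ))
  (hdv : ∀ (μ : Fin (3 + 1)) (y : Site (3 + 1)), dv (μ, y) = r • (Pi.single (wrapPt M y, μ) (1 : ℝ) : (↥(pbox M) × Fin (3 + 1)) → ℝ))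

section H

variable
  -- the road's H-side storey data (as `TowerHN1Row`, labels read off the source)
  (cfF : ℕ → Fin (3 + 1) → Site (3 + 1) → Fin (3 + 1) → Site (3 + 1) → ℝ)
  (hcfF : ∀ (k : ℕ) (μ : Fin (3 + 1)) (s : Site (3 + 1)) (κ' : Fin (3 + 1)) (x : Site (3 + 1)), cfF k μ s κ' x
    = if k = n + 1 then
        ∑ ν : Fin (3 + 1), ∑' w : Site (3 + 1), lamCoeffOf (KInv (N := Lc ^ (n + 1 + 1)) (d := 3)) (Lc ^ (n + 1 + 1)) ν w κ' x
          * compLinKer (fun _ => symLinKerAt (toSite (Roots.ctr Lc).r) Lc) Lc (n + 1) (μ, s) (ν, w)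
      else (if x = (Lc : ℤ) • s ∧ κ' = μ then (1 : ℝ) else 0))
  (hbF : (k : ℕ) → ((↥(pbox M) × Fin (3 + 1)) → ℝ) → (↥(pbox (towerTorus Lc (fine Lc M) k)) × Fin (3 + 1) → ℝ))
  (hhbF : ∀ (k : ℕ) (v : (↥(pbox M) × Fin (3 + 1)) → ℝ) (ā : ↥(pbox (towerTorus Lc (fine Lc M) k)) × Fin (3 + 1)), hbF k v ā
    = if k = n + 1 then hv v (wrapPt (towerTorus Lc (fine Lc M) (n + 1)) (ā.1 : Site (3 + 1)), ā.2)
      else ∑ y₀ : ↥(pbox (towerTorus Lc M k)), (if (ā.1 : Site (3 + 1)) = (Lc : ℤ) • (y₀ : Site (3 + 1)) then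
        ∑ a : ↥(pbox M) × Fin (3 + 1), v a * ∑' nn : Site (3 + 1), ∑ ν : Fin (3 + 1), ∑' w : Site (3 + 1),
          (∑ κ' : Fin (3 + 1), ∑' u' : Site (3 + 1),
              AN (Roots.ctr Lc) (n + 1) u' (((Lc ^ (n + 1 + 1) : ℕ) : ℤ) • (a.1 : Site (3 + 1))) (Sum.inl κ') (Sum.inr a.2)
                * lamCoeffOf (KInv (N := Lc ^ (n + 1 + 1)) (d := 3)) (Lc ^ (n + 1 + 1)) ν w κ' u')
            * compLinKer (fun _ => symLinKerAt (toSite (Roots.ctr Lc).r) Lc) Lc k (ā.2, translate (towerTorus Lc M k) (y₀ : Site (3 + 1)) nn) (ν, w)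
        else 0))
  (κF wF : ℕ → ℝ)
  (hκF : ∀ k, κF k = ∏ i ∈ Finset.Ico k (n + 1), (stepScale 3 Lc (n + 1 - (i + 1)) * ((box (3 + 1) Lc).card : ℝ)))
  (hwF : ∀ k, wF k = (-(c * ((Lc : ℝ) ^ (3 + 1)) ^ (n + 1 + 1))
      / ∏ i ∈ Finset.Ico k (n + 1), (stepScale 3 Lc (n + 1 - (i + 1)) * (Lc : ℝ) ^ (3 + 1))) / κF k)
  (T' : Fin (3 + 1) → ℕ) (hT' : ∀ i, towerTorus Lc (fine Lc M) (n + 1) i = Lc * T' i)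
  (hfold : ∀ (μ : Fin (3 + 1)) (y : Site (3 + 1)) (κ₁ : Fin (3 + 1)) (s₁ : Site (3 + 1)),
      ∑ ā : ↥(pbox (towerTorus Lc (fine Lc M) (n + 1))) × Fin (3 + 1),
          perF (towerTorus Lc (fine Lc M) (n + 1)) (AN (Roots.ctr Lc) (n + 1)) (ā.1, Sum.inl ā.2)
              (wrapPt (towerTorus Lc (fine Lc M) (n + 1)) (((Lc ^ (n + 1 + 1) : ℕ) : ℤ) • y), Sum.inr μ)
            * (∑' m : Site (3 + 1), ∑ ν : Fin (3 + 1), ∑' w : Site (3 + 1),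
                lamCoeffOf (KInv (N := Lc ^ (n + 1 + 1)) (d := 3)) (Lc ^ (n + 1 + 1)) ν w ā.2 (ā.1 : Site (3 + 1))
                  * compLinKer (fun _ => symLinKerAt (toSite (Roots.ctr Lc).r) Lc) Lc (n + 1) (κ₁, translate T' s₁ m) (ν, w))
        = ∑' m : Site (3 + 1), ∑ ν : Fin (3 + 1), ∑' w : Site (3 + 1),
            (∑ κ' : Fin (3 + 1), ∑' u' : Site (3 + 1),
                AN (Roots.ctr Lc) (n + 1) u' (((Lc ^ (n + 1 + 1) : ℕ) : ℤ) • y) (Sum.inl κ') (Sum.inr μ)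
                  * lamCoeffOf (KInv (N := Lc ^ (n + 1 + 1)) (d := 3)) (Lc ^ (n + 1 + 1)) ν w κ' u')
              * compLinKer (fun _ => symLinKerAt (toSite (Roots.ctr Lc).r) Lc) Lc (n + 1) (κ₁, translate T' s₁ m) (ν, w))
  (hcΛ : 2 * P.cΛ (n + 1 + 1) = ((Lc : ℝ) ^ (3 + 1)) ^ (n + 1 + 1) * P.cE (n + 1 + 1))
  {H₀ : Matrix (↥(pbox (towerTorus Lc (fine Lc M) (n + 1))) × Fin (3 + 1)) (↥(pbox (towerTorus Lc (fine Lc M) (n + 1))) × Fin (3 + 1)) ℝ}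
  (hH₀ : H₀ = (perF (towerTorus Lc (fine Lc M) (n + 1)) (bhKStepSh 3 Lc (Dsh Lc) 0)).submatrix
      (fun b : ↥(pbox (towerTorus Lc (fine Lc M) (n + 1))) × Fin (3 + 1) => ((b.1, Sum.inl b.2) : Idx (towerTorus Lc (fine Lc M) (n + 1)) (Fib 3)))
      (fun b : ↥(pbox (towerTorus Lc (fine Lc M) (n + 1))) × Fin (3 + 1) => ((b.1, Sum.inl b.2) : Idx (towerTorus Lc (fine Lc M) (n + 1)) (Fib 3))))
  (hLc : 2 ≤ Lc)
  -- v4's H-side NAMINGS as FAMILIES in the direction (`hH₁f ∕ hH'₁f`, `∀ v`)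
  (H₁f H'₁f : ((↥(pbox M) × Fin (3 + 1)) → ℝ) →
    Matrix (↥(pbox (towerTorus Lc (fine Lc M) (n + 1))) × Fin (3 + 1)) (↥(pbox (towerTorus Lc (fine Lc M) (n + 1))) × Fin (3 + 1)) ℝ)
  (hH₁f : ∀ v, H₁f v = ((-2 * c) • ∑ b : ↥(pbox (towerTorus Lc (fine Lc M) (n + 1))) × Fin (3 + 1), hbF (n + 1) v b •
          (perF (towerTorus Lc (fine Lc M) (n + 1)) (dper (towerTorus Lc (fine Lc M) (n + 1)) (wilsonA 3 b.2 (b.1 : Site (3 + 1))))).submatrix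
            (fun b : ↥(pbox (towerTorus Lc (fine Lc M) (n + 1))) × Fin (3 + 1) => ((b.1, Sum.inl b.2) : Idx (towerTorus Lc (fine Lc M) (n + 1)) (Fib 3)))
            (fun b : ↥(pbox (towerTorus Lc (fine Lc M) (n + 1))) × Fin (3 + 1) => ((b.1, Sum.inl b.2) : Idx (towerTorus Lc (fine Lc M) (n + 1)) (Fib 3)))
        + wF (n + 1) • ∑ ā : ↥(pbox (towerTorus Lc (fine Lc M) (n + 1))) × Fin (3 + 1), hbF (n + 1) v ā •
          (perF (towerTorus Lc (fine Lc M) (n + 1)) (dper (towerTorus Lc (fine Lc M) (n + 1))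
            (SLam N₁ (cfF (n + 1)) (fun μ y => symHessFFAt (toSite (ctrOff (3 + 1) Lc)) Lc μ y) ā.2 (ā.1 : Site (3 + 1))))).submatrix
            (fun b : ↥(pbox (towerTorus Lc (fine Lc M) (n + 1))) × Fin (3 + 1) => ((b.1, Sum.inl b.2) : Idx (towerTorus Lc (fine Lc M) (n + 1)) (Fib 3)))
            (fun b : ↥(pbox (towerTorus Lc (fine Lc M) (n + 1))) × Fin (3 + 1) => ((b.1, Sum.inl b.2) : Idx (towerTorus Lc (fine Lc M) (n + 1)) (Fib 3)))
        + compSumSym Lc (onTowerFamily Lc (fine Lc M) (fun k => wF k • ∑ ā : ↥(pbox (towerTorus Lc (fine Lc M) k)) × Fin (3 + 1), hbF k v ā •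
          (perF (towerTorus Lc (fine Lc M) k) (dper (towerTorus Lc (fine Lc M) k)
            (SLam N₁ (cfF k) (fun μ y => symHessFFAt (toSite (ctrOff (3 + 1) Lc)) Lc μ y) ā.2 (ā.1 : Site (3 + 1))))).submatrix
            (fun b : ↥(pbox (towerTorus Lc (fine Lc M) k)) × Fin (3 + 1) => ((b.1, Sum.inl b.2) : Idx (towerTorus Lc (fine Lc M) k) (Fib 3)))
            (fun b : ↥(pbox (towerTorus Lc (fine Lc M) k)) × Fin (3 + 1) => ((b.1, Sum.inl b.2) : Idx (towerTorus Lc (fine Lc M) k) (Fib 3))))) (fine Lc M) lev rs (n + 1)))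
  (hH'₁f : ∀ v, H'₁f v = -((-(c • Matrix.diagonal (fun b : ↥(pbox (towerTorus Lc (fine Lc M) (n + 1))) × Fin (3 + 1) => lv v b.1)))ᵀ * H₀) + H₁f v
      + H₀ * (-(c • Matrix.diagonal (fun b : ↥(pbox (towerTorus Lc (fine Lc M) (n + 1))) × Fin (3 + 1) => lv v b.1))))

include hlev hhvl hlv hJW hr hdv hcfF hhbF hκF hwF hT' hfold hcΛ hH₀ hLc hH₁f hH'₁f in
/-- [folklore] **`hHN1_family_of_road_data` — v4's ROW `hHN₁ n μ y B` FOR EVERY LABEL `(μ, y)`, `y : ℤ⁴`**: `H′₁f (dv (μ, y)) = (perF T (dper T (VN (Roots.ctr Lc) P (n+1) μ y)))|ff`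
(`TowerHN1Row.hHN1_of_road_data` at the source `(wrapPt M y, μ)` + `perF_dper_VN_wrap`). -/
theorem hHN1_family_of_road_data (μ : Fin (3 + 1)) (y : Site (3 + 1)) :
    H'₁f (dv (μ, y)) = (perF (towerTorus Lc (fine Lc M) (n + 1)) (dper (towerTorus Lc (fine Lc M) (n + 1)) (VN (Roots.ctr Lc) P (n + 1) μ y))).submatrix
          (fun b : ↥(pbox (towerTorus Lc (fine Lc M) (n + 1))) × Fin (3 + 1) => ((b.1, Sum.inl b.2) : Idx (towerTorus Lc (fine Lc M) (n + 1)) (Fib 3)))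
          (fun b : ↥(pbox (towerTorus Lc (fine Lc M) (n + 1))) × Fin (3 + 1) => ((b.1, Sum.inl b.2) : Idx (towerTorus Lc (fine Lc M) (n + 1)) (Fib 3))) := by
  have h := hHN1_of_road_data n M P N₁ lev hlev rs (fun a : ↥(pbox M) × Fin (3 + 1) => (a.1 : Site (3 + 1))) (fun a => a.2) hv cfF hcfF hbF hhbF c κF wF hκF hwF
    T' hT' hhvl lv hlv hJW hfold r hr hcΛ (wrapPt M y, μ) hH₀ hLc (hH₁f _) (hH'₁f _)
  rw [hdv, h]
  show (perF _ (dper _ (VN (Roots.ctr Lc) P (n + 1) μ ((wrapPt M y : ↥(pbox M)) : Site (3 + 1))))).submatrix _ _ = _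
  rw [wrapPt_coe, perF_dper_VN_wrap]

end H

section Q

variable
  -- v4's 𝔔-side letters as FAMILIES (as `TowerQN1Row`)
  (Q₁₀ : Matrix (↥(pbox (fine Lc M)) × Fin (3 + 1)) (↥(pbox (towerTorus Lc (fine Lc M) (n + 1))) × Fin (3 + 1)) ℝ)
  (hQ₁₀ : Q₁₀ = compRowsSym Lc (fine Lc M) (fun i : ℕ => n + 1 - i) (fun _ : ℕ => ctrOff (3 + 1) Lc) (n + 1))
  (Q₂₀ : Matrix (↥(pbox M) × Fin (3 + 1)) (↥(pbox (fine Lc M)) × Fin (3 + 1)) ℝ)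
  (hQ₂₀ : Q₂₀ = (perF (fine Lc M) (bhKStepSh 3 Lc (Dsh Lc) ((n + 1 - 0)))).submatrix
    (fun a : ((↥(pbox M) × Fin (3 + 1))) => ((coarsePt M Lc a.1, Sum.inr (a.2)) : Idx (fine Lc M) (Fib 3)))
    (fun b : (↥(pbox (fine Lc M)) × Fin (3 + 1)) => ((b.1, Sum.inl b.2) : Idx (fine Lc M) (Fib 3))))
  (Q₁₁f : ((↥(pbox M) × Fin (3 + 1)) → ℝ) → Matrix (↥(pbox (fine Lc M)) × Fin (3 + 1)) (↥(pbox (towerTorus Lc (fine Lc M) (n + 1))) × Fin (3 + 1)) ℝ)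
  (hQ₁₁f : ∀ v, Q₁₁f v = c • compIns₁Sym Lc (fine Lc M) (fun i : ℕ => n + 1 - i) (fun _ : ℕ => ctrOff (3 + 1) Lc) (n + 1) (hv v))
  (Q₂₁f : ((↥(pbox M) × Fin (3 + 1)) → ℝ) → Matrix ((↥(pbox M) × Fin (3 + 1))) (↥(pbox (fine Lc M)) × Fin (3 + 1)) ℝ)
  (hQ₂₁f : ∀ v, Q₂₁f v = ∑ a' : (↥(pbox (fine Lc M)) × Fin (3 + 1)), ((c * (((Lc : ℝ) ^ (3 + 1) * stepScale 3 Lc ((n + 1 - 0))) *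
      (∏ i ∈ range (n + 1), (stepScale 3 Lc ((n + 1 - (i + 1))) * ((box (3 + 1) Lc).card : ℝ)))⁻¹)) *
      (compRowsSym Lc (fine Lc M) (fun i : ℕ => n + 1 - i) (fun _ : ℕ => ctrOff (3 + 1) Lc) (n + 1) *ᵥ (hv v)) a') •
      (perF (fine Lc M) (dper (fine Lc M) (symVhSAt (ctr (3 + 1) Lc) 3 Lc rfl a'.2 (a'.1 : Site (3 + 1))))).submatrix
        (fun k : (↥(pbox M) × Fin (3 + 1)) => (((coarsePt M Lc k.1, Sum.inr (k.2)) : Idx (fine Lc M) (Fib 3))))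
        (fun b : (↥(pbox (fine Lc M)) × Fin (3 + 1)) => ((b.1, Sum.inl b.2) : Idx (fine Lc M) (Fib 3))))
  (𝔔₀ : Matrix ((↥(pbox M) × Fin (3 + 1))) (↥(pbox (towerTorus Lc (fine Lc M) (n + 1))) × Fin (3 + 1)) ℝ)
  (h𝔔₀ : Q₂₀ * Q₁₀ = 𝔔₀)
  (𝔔₁f : ((↥(pbox M) × Fin (3 + 1)) → ℝ) → Matrix ((↥(pbox M) × Fin (3 + 1))) (↥(pbox (towerTorus Lc (fine Lc M) (n + 1))) × Fin (3 + 1)) ℝ)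
  (h𝔔₁ : ∀ v, Q₂₁f v * Q₁₀ + Q₂₀ * Q₁₁f v = 𝔔₁f v)
  (Xbf : ((↥(pbox M) × Fin (3 + 1)) → ℝ) → Matrix ((↥(pbox M) × Fin (3 + 1))) ((↥(pbox M) × Fin (3 + 1))) ℝ)
  (hXbf : ∀ v, Xbf v = c • Matrix.diagonal (fun a : (↥(pbox M) × Fin (3 + 1)) =>
    lv v (itRoot Lc M (fun _ : ℕ => ctrOff (3 + 1) Lc) (fun _ => hc) (n + 1 + 1) a.1)))
  (𝔔'₁f : ((↥(pbox M) × Fin (3 + 1)) → ℝ) → Matrix ((↥(pbox M) × Fin (3 + 1))) (↥(pbox (towerTorus Lc (fine Lc M) (n + 1))) × Fin (3 + 1)) ℝ)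
  (h𝔔'₁f : ∀ v, 𝔔'₁f v = Xbf v * 𝔔₀ + 𝔔₁f v
    + 𝔔₀ * (-(c • Matrix.diagonal (fun b : (↥(pbox (towerTorus Lc (fine Lc M) (n + 1))) × Fin (3 + 1)) => lv v b.1))))
  (fN : (↥(pbox M) × Fin (3 + 1)) → Idx (towerTorus Lc (fine Lc M) (n + 1)) (Fib 3))
  (hfN : ∀ a : ↥(pbox M) × Fin (3 + 1),
    fN a = (wrapPt (towerTorus Lc (fine Lc M) (n + 1)) (((Lc ^ (n + 1 + 1) : ℕ) : ℤ) • (a.1 : Site (3 + 1))), Sum.inr a.2))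
  (hcVH : 2 * P.cVH (n + 1 + 1) = -((∏ ℓ ∈ range (n + 1 + 1), (stepScale 3 Lc ℓ * (Lc : ℝ) ^ (3 + 1))) * P.cE (n + 1 + 1)))

include hhvl hlv hJW hr hdv hQ₁₀ hQ₂₀ hQ₁₁f hQ₂₁f h𝔔₀ h𝔔₁ hXbf h𝔔'₁f hfN hcVH in
/-- [folklore] **`hQN1_family_of_road_data` — v4's ROW `hQN₁ n μ y B` FOR EVERY LABEL `(μ, y)`, `y : ℤ⁴`**:
`𝔔′₁f (dv (μ, y)) = (perF T (dper T (VN (Roots.ctr Lc) P (n+1) μ y))).submatrix fN (·♭)` (`TowerQN1Row.hQN1_of_road_data` at the source `(wrapPt M y, μ)` + `perF_dper_VN_wrap`). -/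
theorem hQN1_family_of_road_data (μ : Fin (3 + 1)) (y : Site (3 + 1)) :
    𝔔'₁f (dv (μ, y))
      = (perF (towerTorus Lc (fine Lc M) (n + 1)) (dper (towerTorus Lc (fine Lc M) (n + 1)) (VN (Roots.ctr Lc) P (n + 1) μ y))).submatrix fN
          (fun b : (↥(pbox (towerTorus Lc (fine Lc M) (n + 1))) × Fin (3 + 1)) => ((b.1, Sum.inl b.2) : Idx (towerTorus Lc (fine Lc M) (n + 1)) (Fib 3))) := by
  have h := hQN1_of_road_data M n c P hc (fun a : ↥(pbox M) × Fin (3 + 1) => (a.1 : Site (3 + 1))) (fun a => a.2) hv hhvl lv hlv hJW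
    Q₁₀ hQ₁₀ Q₂₀ hQ₂₀ Q₁₁f hQ₁₁f Q₂₁f hQ₂₁f 𝔔₀ h𝔔₀ 𝔔₁f h𝔔₁ Xbf hXbf 𝔔'₁f h𝔔'₁f fN hfN r hr hcVH (wrapPt M y, μ)
  rw [hdv, h]
  show (perF _ (dper _ (VN (Roots.ctr Lc) P (n + 1) μ ((wrapPt M y : ↥(pbox M)) : Site (3 + 1))))).submatrix _ _ = _
  rw [wrapPt_coe, perF_dper_VN_wrap]

end Q

end Families

end Summit.QuantumFields.BalabanUV.Beta.FP.TowerN1RowsFamily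

end
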